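import Mathlib
import Summits.KontsevichZagierPeriods.Zeta5Search.Families.BasicGrowthBounds
import HarnessLib

/-!
# ζ(5) search — Families: the two-cover count of a convergent seating — `2|Z| ≤ N₁(Z) + N₂(Z)` for every gap set `Z`

HONEST FRAMING: systematic search; no irrationality claim unless certified.  COMBINATORIAL facts about convergent
seatings (Brown's dinner-party condition [Brown2016, §1.5, §3.1]); nothing about the arithmetic of any zeta value.
Seat P2, Families layer.  They are the combinatorial half of the universal growth bound `M_σ ≤ 2^{−(ℓ+1)}` of
`Families/BasicGrowthHalfPow.lean`.

Setting (`Families/CellularEdges.lean`): `n = ℓ + 3` marked points, the finite ones `z_0 < ⋯ < z_{ℓ+1}` and `∞`;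
the `ℓ + 1` GAPS `w` (between `z_w` and `z_{w+1}`); for a bijective seating `σ` the finite `σδ⁰`-edges
`{z_{σ_i}, z_{σ_{i+1}}}` (index `SEdge σ`, `ℓ + 1` of them, `card_sEdge`), each with its SPAN (the gaps between its
endpoints, an interval).  For a gap set `Z` put `N₁(Z) = #{edges whose span meets Z}` and
`N₂(Z) = #{edges whose span meets Z in at least two gaps}`.
* `card_edges_inside_add_two_le` — for a CONVERGENT `σ`, a proper block `B = {z_p,…,z_q}` of `2 ≤ |B| ≤ n − 2`
  finite points contains at most `|B| − 2` edges of the polygon `σδ⁰` (the Hamiltonian cycle `σ` crosses the cut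
  `B | Bᶜ` at least four times, `four_le_card_bdry_of_convergent`, i.e. leaves `B` at least twice);
* `card_filter_span_subset_add_card_le` — DEFICIENCY WITH BONUS: for a gap set `L ≠ univ` and `T ⊆ L` such that
  between any two gaps of `T` lies a gap outside `L`, `#{edges with span ⊆ L} + |T| ≤ |L|` (each maximal run of `L`
  holds at most one gap of `T` and, by the previous item, at most `|run| − 1` spans; cf. `card_filter_span_subset_le`
  of `Families/BasicMonotone.lean`, the case `T = ∅` without convergence);
* `card_le_meetCount` — hence `N₁(Z₁) ≥ |Z₁| + |Z₂|` whenever `Z₁ ≠ ∅`, `Z₂ ∩ Z₁ = ∅` and consecutive gaps of `Z₂` are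
  separated by a gap of `Z₁`;
* **`two_mul_card_le_meetCount_add_meetTwiceCount`** — THE TWO-COVER COUNT: for a convergent bijective seating on
  `n ≥ 4` points and EVERY non-empty gap set `Z`, **`2|Z| ≤ N₁(Z) + N₂(Z)`**.  Proof: split `Z` by the parity of the
  rank into `Z₁ ⊔ Z₂` (alternating gaps); consecutive gaps of each part are separated by a gap of the other, so
  `N₁(Z₁), N₁(Z₂) ≥ |Z|`, and `N₁(Z₁) + N₁(Z₂) ≤ N₁(Z) + N₂(Z)` because an edge meeting both parts meets `Z` twice.
By max-flow/min-cut this count is exactly the condition for the edge/gap containment graph to have a `2`-factor (two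
gap-disjoint Hall matchings, the hypothesis of `fSigma_le_half_pow_of_two_sdr` in `Families/BasicGrowthTwoFactor.lean`);
`Families/BasicGrowthHalfPow.lean` uses it directly, through one Hall matching of thresholds.  Standard axioms only.
-/

noncomputable section

open Finset

namespace Summit.KontsevichZagierPeriods.Zeta5Search.Families.Cellular

variable {ℓ : ℕ} (σ : Fin (ℓ + 3) → Fin (ℓ + 3))

/-! ### A proper block holds at most `|B| − 2` edges of a convergent seating -/

/-- For a CONVERGENT bijective seating and a proper block `B = {z_p, …, z_q}` of finite points (`p < q ≤ ℓ + 1`,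
`q − p ≤ ℓ`, i.e. `2 ≤ |B| ≤ n − 2`), at most `|B| − 2` positions `i` have both `σ_i` and `σ_{i+1}` in `B`: the
Hamiltonian cycle `σ` leaves `B` at least twice. [Brown2016, proof of Lemma 3.8] -/
theorem card_edges_inside_add_two_le (hσ : Function.Bijective σ) (hc : Convergent σ) {p q : ℕ} (hpq : p < q)
    (hq : q ≤ ℓ + 1) (hqp : q - p ≤ ℓ) :
    (univ.filter fun i => σ i ∈ vblock ℓ p q ∧ σ (i + 1) ∈ vblock ℓ p q).card + 2 ≤ (vblock ℓ p q).card := by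
  classical
  set B := vblock ℓ p q with hB
  set T : Finset (Fin (ℓ + 3)) := univ.filter fun i => σ i ∈ B with hT
  have harc : arc (⟨p, by omega⟩ : Fin (ℓ + 3)) (q - p + 1) = B := arc_eq_vblock hpq hq
  have hTcard : T.card = q - p + 1 := by
    rw [hT, ← harc]
    exact card_filter_mem_arc hσ _ (by omega)
  have h4 : 4 ≤ (bdry T).card := by
    have := four_le_card_bdry_of_convergent hσ hc (⟨p, by omega⟩ : Fin (ℓ + 3)) (k := q - p + 1)
      (by omega) (by omega)
    rwa [harc] at this
  rw [card_bdry_eq_two_mul, ← card_falls_eq_card_rises] at h4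
  -- `T` splits into the positions of edges inside `B` and the falls
  have hsplit := Finset.card_filter_add_card_filter_not (s := T) (fun i : Fin (ℓ + 3) => σ (i + 1) ∈ B)
  have h1 : T.filter (fun i => σ (i + 1) ∈ B) = univ.filter fun i => σ i ∈ B ∧ σ (i + 1) ∈ B := by
    ext i; simp [hT]
  have h2 : T.filter (fun i => ¬ σ (i + 1) ∈ B) = falls T := by
    ext i; simp [hT, falls]
  rw [h1, h2, hTcard] at hsplit
  rw [card_vblock p q hq]
  omega

/-! ### Deficiency with bonus -/

/-- **Deficiency with bonus.**  For a convergent bijective seating, a gap set `L ≠ univ` and a subset `T ⊆ L` which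
is `L`-SEPARATED (between any two gaps of `T` lies a gap outside `L`, so each maximal run of `L` holds at most one
gap of `T`): the number of finite `σδ⁰`-edges with span inside `L`, plus `|T|`, is at most `|L|`. -/
theorem card_filter_span_subset_add_card_le (hσ : Function.Bijective σ) (hc : Convergent σ) :
    ∀ n : ℕ, ∀ L T : Finset (Fin (ℓ + 1)), L.card = n → L ≠ univ → T ⊆ L →
      (∀ a ∈ T, ∀ b ∈ T, a < b → ∃ w, w ∉ L ∧ a < w ∧ w < b) →
      (univ.filter fun i : SEdge σ => (cellEdges σ hσ.1).span (Sum.inr i) ⊆ L).card + T.card ≤ L.card := by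
  -- adapted from `card_filter_span_subset_le` (Families/BasicMonotone.lean): same run/split induction, with `T`
  classical
  intro n
  induction n using Nat.strong_induction_on with
  | _ n ih =>
    intro L T hLn hLu hTL hsep
    rcases L.eq_empty_or_nonempty with rfl | hne
    · have hT : T = ∅ := Finset.subset_empty.1 hTL
      rw [hT, Finset.card_empty, Nat.add_zero, Nat.le_zero, Finset.card_eq_zero, Finset.filter_eq_empty_iff]
      intro i _ h
      obtain ⟨w, hw⟩ := (cellEdges σ hσ.1).span_nonempty (Sum.inr i)
      exact Finset.notMem_empty w (h hw)
    have hLlt : L.card < ℓ + 1 := by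
      have := Finset.card_lt_card (Finset.ssubset_univ_iff.2 hLu)
      rwa [Finset.card_univ, Fintype.card_fin] at this
    set p : ℕ := (L.min' hne).val with hp
    set q : ℕ := (L.max' hne).val + 1 with hq
    have hsub : L ⊆ gapRun ℓ p q := by
      intro w hw
      rw [mem_gapRun]
      exact ⟨Fin.le_def.1 (L.min'_le w hw), Nat.lt_succ_of_le (Fin.le_def.1 (L.le_max' w hw))⟩
    by_cases hrun : gapRun ℓ p q ⊆ L
    · -- `L` is a run: at most one gap of `T`, at most `|L| - 1` spans (convergence)
      have hL : L = gapRun ℓ p q := Finset.Subset.antisymm hsub hrun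
      have hpq : p < q := by have := Fin.le_def.1 (L.min'_le _ (L.max'_mem hne)); omega
      have hq' : q ≤ ℓ + 1 := by have := (L.max' hne).isLt; omega
      have hcardL : L.card = q - p := by rw [hL, card_gapRun p q hq']
      have hqp : q - p ≤ ℓ := by omega
      -- `T` has at most one element
      have hT1 : T.card ≤ 1 := by
        by_contra hT2
        rw [not_le, Finset.one_lt_card] at hT2
        obtain ⟨a, ha, b, hb, hab⟩ := hT2
        have key : ∀ a ∈ T, ∀ b ∈ T, a < b → False := by
          intro a ha b hb hlt
          obtain ⟨w, hwL, haw, hwb⟩ := hsep a ha b hb hlt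
          apply hwL
          apply hrun
          rw [mem_gapRun]
          have ha' := (mem_gapRun p q a).1 (hsub (hTL ha))
          have hb' := (mem_gapRun p q b).1 (hsub (hTL hb))
          have h1 := Fin.lt_def.1 haw
          have h2 := Fin.lt_def.1 hwb
          omega
        rcases lt_or_gt_of_ne hab with h | h
        · exact key a ha b hb h
        · exact key b hb a ha h
      -- spans inside `L` are edges inside the block `{z_p, …, z_q}`
      have hle : (univ.filter fun i : SEdge σ => (cellEdges σ hσ.1).span (Sum.inr i) ⊆ L).card ≤
          (univ.filter fun i : Fin (ℓ + 3) => σ i ∈ vblock ℓ p q ∧ σ (i + 1) ∈ vblock ℓ p q).card := by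
        refine Finset.card_le_card_of_injOn (fun i => i.1) (fun i hi => ?_) (fun i _ j _ h => Subtype.ext h)
        simp only [Finset.coe_filter, Finset.mem_univ, true_and, Set.mem_setOf_eq] at hi ⊢
        rw [hL, (cellEdges σ hσ.1).span_subset_gapRun_iff] at hi
        simp only [cellEdges, Sum.elim_inr] at hi
        rw [mem_vblock, mem_vblock]
        omega
      have hins := card_edges_inside_add_two_le σ hσ hc hpq hq' hqp
      rw [card_vblock p q hq'] at hins
      omega
    · -- split at a missing gap
      obtain ⟨w0, hw0r, hw0L⟩ := Finset.not_subset.1 hrun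
      set L1 := L.filter (fun w => w.val < w0.val) with hL1
      set L2 := L.filter (fun w => ¬ w.val < w0.val) with hL2
      set T1 := T.filter (fun w => w.val < w0.val) with hT1
      set T2 := T.filter (fun w => ¬ w.val < w0.val) with hT2
      have hmin1 : L.min' hne ∈ L1 := by
        rw [hL1, Finset.mem_filter]
        refine ⟨L.min'_mem hne, ?_⟩
        have h1 : p ≤ w0.val := ((mem_gapRun p q w0).1 hw0r).1
        have h2 : (L.min' hne).val ≠ w0.val := fun h => hw0L ((Fin.ext h) ▸ L.min'_mem hne)
        omega
      have hmax2 : L.max' hne ∈ L2 := by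
        rw [hL2, Finset.mem_filter]
        refine ⟨L.max'_mem hne, ?_⟩
        have h1 : w0.val < q := ((mem_gapRun p q w0).1 hw0r).2
        omega
      have hne1 : L1.Nonempty := ⟨_, hmin1⟩
      have hne2 : L2.Nonempty := ⟨_, hmax2⟩
      have hdisj : Disjoint L1 L2 := by
        rw [hL1, hL2]; exact Finset.disjoint_filter_filter_not L L fun w => w.val < w0.val
      have hunion : L1 ∪ L2 = L := by rw [hL1, hL2]; exact Finset.filter_union_filter_not_eq _ L
      have hcardsum : L1.card + L2.card = L.card := by rw [← Finset.card_union_of_disjoint hdisj, hunion]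
      have hTdisj : Disjoint T1 T2 := by
        rw [hT1, hT2]; exact Finset.disjoint_filter_filter_not T T fun w => w.val < w0.val
      have hTunion : T1 ∪ T2 = T := by rw [hT1, hT2]; exact Finset.filter_union_filter_not_eq _ T
      have hTcardsum : T1.card + T2.card = T.card := by rw [← Finset.card_union_of_disjoint hTdisj, hTunion]
      have hL1u : L1 ≠ univ := fun h => hw0L (Finset.filter_subset _ L (h ▸ Finset.mem_univ w0))
      have hL2u : L2 ≠ univ := fun h => hw0L (Finset.filter_subset _ L (h ▸ Finset.mem_univ w0))
      have hT1L1 : T1 ⊆ L1 := by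
        rw [hT1, hL1]; exact Finset.filter_subset_filter _ hTL
      have hT2L2 : T2 ⊆ L2 := by
        rw [hT2, hL2]; exact Finset.filter_subset_filter _ hTL
      have hsep1 : ∀ a ∈ T1, ∀ b ∈ T1, a < b → ∃ w, w ∉ L1 ∧ a < w ∧ w < b := by
        intro a ha b hb hab
        obtain ⟨w, hwL, h1, h2⟩ := hsep a (Finset.filter_subset _ T ha) b (Finset.filter_subset _ T hb) hab
        exact ⟨w, fun h => hwL (Finset.filter_subset _ L h), h1, h2⟩
      have hsep2 : ∀ a ∈ T2, ∀ b ∈ T2, a < b → ∃ w, w ∉ L2 ∧ a < w ∧ w < b := by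
        intro a ha b hb hab
        obtain ⟨w, hwL, h1, h2⟩ := hsep a (Finset.filter_subset _ T ha) b (Finset.filter_subset _ T hb) hab
        exact ⟨w, fun h => hwL (Finset.filter_subset _ L h), h1, h2⟩
      have h1 := ih L1.card (by have := hne2.card_pos; omega) L1 T1 rfl hL1u hT1L1 hsep1
      have h2 := ih L2.card (by have := hne1.card_pos; omega) L2 T2 rfl hL2u hT2L2 hsep2
      have hfilt : (univ.filter fun i : SEdge σ => (cellEdges σ hσ.1).span (Sum.inr i) ⊆ L) ⊆
          (univ.filter fun i : SEdge σ => (cellEdges σ hσ.1).span (Sum.inr i) ⊆ L1) ∪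
            (univ.filter fun i : SEdge σ => (cellEdges σ hσ.1).span (Sum.inr i) ⊆ L2) := by
        intro i hi
        simp only [Finset.mem_filter, Finset.mem_univ, true_and, Finset.mem_union] at hi ⊢
        exact ((cellEdges σ hσ.1).span_subset_split L w0 hw0L (Sum.inr i)).1 hi
      have := Finset.card_le_card hfilt
      have := Finset.card_union_le
        (univ.filter fun i : SEdge σ => (cellEdges σ hσ.1).span (Sum.inr i) ⊆ L1)
        (univ.filter fun i : SEdge σ => (cellEdges σ hσ.1).span (Sum.inr i) ⊆ L2)
      omega

/-! ### Counting edges that meet a gap set -/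

/-- `N₁(Z)`: the number of finite `σδ⁰`-edges whose span meets the gap set `Z`. -/
def meetCount (hσ : Function.Bijective σ) (Z : Finset (Fin (ℓ + 1))) : ℕ :=
  (univ.filter fun i : SEdge σ => ((cellEdges σ hσ.1).span (Sum.inr i) ∩ Z).Nonempty).card

/-- `N₂(Z)`: the number of finite `σδ⁰`-edges whose span meets the gap set `Z` in at least two gaps. -/
def meetTwiceCount (hσ : Function.Bijective σ) (Z : Finset (Fin (ℓ + 1))) : ℕ :=
  (univ.filter fun i : SEdge σ => 2 ≤ ((cellEdges σ hσ.1).span (Sum.inr i) ∩ Z).card).card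

/-- `N₁(Z) + #{edges with span ⊆ Zᶜ} = ℓ + 1`. -/
theorem meetCount_add_card_filter_subset_compl (hσ : Function.Bijective σ) (Z : Finset (Fin (ℓ + 1))) :
    meetCount σ hσ Z + (univ.filter fun i : SEdge σ => (cellEdges σ hσ.1).span (Sum.inr i) ⊆ Zᶜ).card =
      ℓ + 1 := by
  classical
  unfold meetCount
  have h := Finset.card_filter_add_card_filter_not (s := (univ : Finset (SEdge σ)))
    (fun i : SEdge σ => ((cellEdges σ hσ.1).span (Sum.inr i) ∩ Z).Nonempty)
  rw [Finset.card_univ, card_sEdge σ hσ] at h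
  have hfilt : (univ.filter fun i : SEdge σ => (cellEdges σ hσ.1).span (Sum.inr i) ⊆ Zᶜ) =
      univ.filter fun i : SEdge σ => ¬ ((cellEdges σ hσ.1).span (Sum.inr i) ∩ Z).Nonempty := by
    ext i
    simp only [Finset.mem_filter, Finset.mem_univ, true_and]
    rw [Finset.not_nonempty_iff_eq_empty, ← Finset.disjoint_iff_inter_eq_empty,
      Finset.subset_compl_iff_disjoint_right]
  rw [hfilt]
  exact h

/-- **`N₁(Z₁) ≥ |Z₁| + |Z₂|`** for a convergent bijective seating, `Z₁ ≠ ∅`, `Z₂` disjoint from `Z₁` and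
`Z₁ᶜ`-separated (between two gaps of `Z₂` lies a gap of `Z₁`). -/
theorem card_le_meetCount (hσ : Function.Bijective σ) (hc : Convergent σ) {Z₁ Z₂ : Finset (Fin (ℓ + 1))}
    (hne : Z₁.Nonempty) (hdisj : Disjoint Z₁ Z₂) (hsep : ∀ a ∈ Z₂, ∀ b ∈ Z₂, a < b → ∃ w, w ∈ Z₁ ∧ a < w ∧ w < b) :
    Z₁.card + Z₂.card ≤ meetCount σ hσ Z₁ := by
  classical
  have h := card_filter_span_subset_add_card_le σ hσ hc _ Z₁ᶜ Z₂ rfl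
    (by
      intro hu
      obtain ⟨w, hw⟩ := hne
      have : w ∈ Z₁ᶜ := hu ▸ Finset.mem_univ w
      exact (Finset.mem_compl.1 this) hw)
    (by
      intro w hw
      rw [Finset.mem_compl]
      exact fun h1 => Finset.disjoint_left.1 hdisj h1 hw)
    (fun a ha b hb hab => by
      obtain ⟨w, hw, h1, h2⟩ := hsep a ha b hb hab
      exact ⟨w, fun h => (Finset.mem_compl.1 h) hw, h1, h2⟩)
  have h2 := meetCount_add_card_filter_subset_compl σ hσ Z₁
  have h3 : Z₁ᶜ.card = ℓ + 1 - Z₁.card := by rw [Finset.card_compl, Fintype.card_fin]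
  have h4 : Z₁.card ≤ ℓ + 1 := by
    have := Finset.card_le_univ Z₁; rwa [Fintype.card_fin] at this
  omega

/-- `N₁(Z₁) + N₁(Z₂) ≤ N₁(Z) + N₂(Z)` for disjoint `Z₁, Z₂ ⊆ Z`: an edge meeting both parts meets `Z` twice. -/
theorem meetCount_add_meetCount_le (hσ : Function.Bijective σ) {Z Z₁ Z₂ : Finset (Fin (ℓ + 1))}
    (h₁ : Z₁ ⊆ Z) (h₂ : Z₂ ⊆ Z) (hdisj : Disjoint Z₁ Z₂) :
    meetCount σ hσ Z₁ + meetCount σ hσ Z₂ ≤ meetCount σ hσ Z + meetTwiceCount σ hσ Z := by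
  classical
  unfold meetCount meetTwiceCount
  set E := cellEdges σ hσ.1
  set A := univ.filter fun i : SEdge σ => (E.span (Sum.inr i) ∩ Z₁).Nonempty
  set B := univ.filter fun i : SEdge σ => (E.span (Sum.inr i) ∩ Z₂).Nonempty
  rw [← Finset.card_union_add_card_inter A B]
  refine Nat.add_le_add (Finset.card_le_card fun i hi => ?_) (Finset.card_le_card fun i hi => ?_)
  · simp only [A, B, Finset.mem_union, Finset.mem_filter, Finset.mem_univ, true_and] at hi ⊢
    rcases hi with ⟨w, hw⟩ | ⟨w, hw⟩
    · rw [Finset.mem_inter] at hw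
      exact ⟨w, Finset.mem_inter.2 ⟨hw.1, h₁ hw.2⟩⟩
    · rw [Finset.mem_inter] at hw
      exact ⟨w, Finset.mem_inter.2 ⟨hw.1, h₂ hw.2⟩⟩
  · simp only [A, B, Finset.mem_inter, Finset.mem_filter, Finset.mem_univ, true_and] at hi ⊢
    obtain ⟨⟨a, ha⟩, ⟨b, hb⟩⟩ := hi
    rw [Finset.mem_inter] at ha hb
    have hab : a ≠ b := fun h => Finset.disjoint_left.1 hdisj ha.2 (h ▸ hb.2)
    exact Finset.one_lt_card.2 ⟨a, Finset.mem_inter.2 ⟨ha.1, h₁ ha.2⟩, b, Finset.mem_inter.2 ⟨hb.1, h₂ hb.2⟩, hab⟩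

/-! ### The two-cover count -/

/-- Alternation along an increasing enumeration: two gaps with indices in `P` are separated by a gap with index in
`Q`, provided `P m → ¬ P (m+1)` and `¬ P m → Q m`. -/
private theorem exists_between_alternate {k : ℕ} (f : Fin k ↪o Fin (ℓ + 1)) {P Q : ℕ → Prop} [DecidablePred P]
    [DecidablePred Q] (h1 : ∀ m, P m → ¬ P (m + 1)) (h2 : ∀ m, ¬ P m → Q m) {a b : Fin (ℓ + 1)}
    (ha : a ∈ (univ.filter fun j : Fin k => P j.val).image f)
    (hb : b ∈ (univ.filter fun j : Fin k => P j.val).image f) (hab : a < b) :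
    ∃ w, w ∈ (univ.filter fun j : Fin k => Q j.val).image f ∧ a < w ∧ w < b := by
  obtain ⟨i, hi, rfl⟩ := Finset.mem_image.1 ha
  obtain ⟨j, hj, rfl⟩ := Finset.mem_image.1 hb
  simp only [Finset.mem_filter, Finset.mem_univ, true_and] at hi hj
  have hij : i < j := f.lt_iff_lt.1 hab
  have hij' : i.val + 2 ≤ j.val := by
    have h := Fin.lt_def.1 hij
    by_contra hlt
    have hj' : j = ⟨i.val + 1, by omega⟩ := Fin.ext (by simp only; omega)
    rw [hj'] at hj
    exact h1 _ hi hj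
  let m : Fin k := ⟨i.val + 1, by omega⟩
  refine ⟨f m, Finset.mem_image.2 ⟨m, ?_, rfl⟩, f.strictMono (Fin.lt_def.2 (by simp [m])),
    f.strictMono (Fin.lt_def.2 (by simp only [m]; omega))⟩
  simp only [Finset.mem_filter, Finset.mem_univ, true_and, m]
  exact h2 _ (h1 _ hi)

/-- **The two-cover count.**  For a CONVERGENT bijective seating on `n = ℓ + 3 ≥ 4` points and every non-empty set
`Z` of gaps: `2|Z| ≤ N₁(Z) + N₂(Z)` — the finite `σδ⁰`-edges meeting `Z`, counted once if they meet it in one gap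
and twice if in at least two, number at least `2|Z|`. -/
theorem two_mul_card_le_meetCount_add_meetTwiceCount (hσ : Function.Bijective σ) (hc : Convergent σ)
    (hℓ : 1 ≤ ℓ) {Z : Finset (Fin (ℓ + 1))} (hZ : Z.Nonempty) :
    2 * Z.card ≤ meetCount σ hσ Z + meetTwiceCount σ hσ Z := by
  classical
  have htot := meetCount_add_card_filter_subset_compl σ hσ Z
  have hZu : Zᶜ ≠ (univ : Finset (Fin (ℓ + 1))) := by
    intro hu
    obtain ⟨w, hw⟩ := hZ
    exact (Finset.mem_compl.1 (hu ▸ Finset.mem_univ w)) hw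
  have hZc : Zᶜ.card = ℓ + 1 - Z.card := by rw [Finset.card_compl, Fintype.card_fin]
  by_cases hk : Z.card = 1
  · -- one gap `ζ`: any other gap `w` is a `Zᶜ`-separated singleton, so `N₁(Z) ≥ 2`
    obtain ⟨ζ, rfl⟩ := Finset.card_eq_one.1 hk
    let w : Fin (ℓ + 1) := if (ζ : ℕ) = 0 then ⟨1, by omega⟩ else ⟨0, by omega⟩
    have hw : w ≠ ζ := by
      intro h
      have h' := congrArg Fin.val h
      by_cases h0 : (ζ : ℕ) = 0
      · simp only [w, h0, if_true] at h'; omega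
      · simp only [w, h0, if_false] at h'; omega
    have h := card_filter_span_subset_add_card_le σ hσ hc _ {ζ}ᶜ {w} rfl hZu
      (by
        intro x hx
        rw [Finset.mem_singleton] at hx
        rw [hx, Finset.mem_compl, Finset.mem_singleton]
        exact hw)
      (by
        intro a ha b hb hab
        rw [Finset.mem_singleton] at ha hb
        rw [ha, hb] at hab
        exact absurd hab (lt_irrefl _))
    rw [Finset.card_singleton] at h hk ⊢
    rw [Finset.card_singleton] at hZc
    omega
  · -- at least two gaps: split `Z` alternately along its increasing enumeration
    have hk2 : 2 ≤ Z.card := by have := hZ.card_pos; omega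
    set k := Z.card with hkdef
    let f : Fin k ↪o Fin (ℓ + 1) := Z.orderEmbOfFin hkdef.symm
    set Z₁ := (univ.filter fun j : Fin k => j.val % 2 = 0).image f with hZ₁
    set Z₂ := (univ.filter fun j : Fin k => ¬ j.val % 2 = 0).image f with hZ₂
    have hmem : ∀ j, f j ∈ Z := fun j => Finset.orderEmbOfFin_mem Z hkdef.symm j
    have h₁ : Z₁ ⊆ Z := by
      intro x hx
      obtain ⟨j, -, rfl⟩ := Finset.mem_image.1 hx
      exact hmem j
    have h₂ : Z₂ ⊆ Z := by
      intro x hx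
      obtain ⟨j, -, rfl⟩ := Finset.mem_image.1 hx
      exact hmem j
    have hdisj : Disjoint Z₁ Z₂ := by
      rw [hZ₁, hZ₂, Finset.disjoint_image f.injective]
      exact Finset.disjoint_filter_filter_not _ _ _
    have hcard : Z₁.card + Z₂.card = k := by
      rw [hZ₁, hZ₂, Finset.card_image_of_injective _ f.injective, Finset.card_image_of_injective _ f.injective,
        Finset.card_filter_add_card_filter_not, Finset.card_univ, Fintype.card_fin]
    have hne₁ : Z₁.Nonempty :=
      ⟨f ⟨0, by omega⟩, Finset.mem_image.2 ⟨⟨0, by omega⟩, by simp, rfl⟩⟩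
    have hne₂ : Z₂.Nonempty :=
      ⟨f ⟨1, by omega⟩, Finset.mem_image.2 ⟨⟨1, by omega⟩, by simp, rfl⟩⟩
    -- alternation: consecutive gaps of one part are separated by a gap of the other
    have hsep₂ : ∀ a ∈ Z₂, ∀ b ∈ Z₂, a < b → ∃ w, w ∈ Z₁ ∧ a < w ∧ w < b := fun a ha b hb hab =>
      exists_between_alternate f (P := fun m => ¬ m % 2 = 0) (Q := fun m => m % 2 = 0)
        (fun m hm => by omega) (fun m hm => by omega) ha hb hab
    have hsep₁ : ∀ a ∈ Z₁, ∀ b ∈ Z₁, a < b → ∃ w, w ∈ Z₂ ∧ a < w ∧ w < b := fun a ha b hb hab =>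
      exists_between_alternate f (P := fun m => m % 2 = 0) (Q := fun m => ¬ m % 2 = 0)
        (fun m hm => by omega) (fun m hm => hm) ha hb hab
    have hA := card_le_meetCount σ hσ hc hne₁ hdisj hsep₂
    have hB := card_le_meetCount σ hσ hc hne₂ hdisj.symm hsep₁
    have hC := meetCount_add_meetCount_le σ hσ h₁ h₂ hdisj
    omega

end Summit.KontsevichZagierPeriods.Zeta5Search.Families.Cellular
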